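import Summits.CriticalPhenomena.PercolationContinuityZ3.Theorems.PercNearOneGluingNoHeavyQuantHyperscalingTransfers
import Literature.Barriers.CriticalPhenomena.KozmaNachmiasLemma23B3
import HarnessLib

/-!
# PAPER-2 track, ARM-3 gen 4: (T1) is EQUIVALENT to a power-law critical volume tail (bookkeeping for §12's landscape sentence)

builds on p205010 (kernel theorem, internal audit signed; external expert review pending).
Status sentence for p205010: "θ(p_c) = 0 on ℤ^d, all d ≥ 2 — kernel-verified (Lean 4/Mathlib, standard
axioms); internal adversarial audit SIGNED 2026-08-20 04:29Z; external expert review pending."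

Two directions already in the tree are assembled into one `↔`, so that the paper can say "the missing input (T1) has an
equivalent VOLUME form": `OneArmPolyDecay d` (∃ c > 0, C with `P_{p_c}(0 ↔ ∂Λ_n) ≤ C n^{−c}`) holds iff
`∃ a > 0, A` with `P_{p_c}(|C(0)| ≥ k) ≤ A k^{−a}` for all `k ≥ 1` (`d ≥ 2`).  Forward: the two-box volume lemma
`volumeTail_criticalProbI_of_oneArmPolyDecay` (gen 3; exponent `a = c/(d−c)`); backward: `{0 ↔ ∂Λ_n} ⊆ {|C(0)| ≥ n+1}`
(`Literature.Barriers.CriticalPhenomena.oneArmProb_le_real_clusterSizeGe`; exponent `c = a`).  The round trip `c ↦ c/(d−c)` is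
lossy (hyperscaling predicts `1/δ = (1/ρ)/(d − 1/ρ)` exactly, and `1/ρ > 1/δ`), so this is an equivalence of the EXISTENTIAL
statements only.  With `Hutchcroft2020_gamma_le_delta_sub_one_holds` (gen 4, Literature) the volume form feeds route (C):
exponent `a > 1/3` gives `γ' ≤ 1/a − 1 < 2`.  Helper of item stmt-CriticalPhenomena-4575; nothing here is an input of p205010.
-/

noncomputable section

open MeasureTheory Literature.Probability.Percolation Literature.Probability.LatticeModels

namespace Summit.CriticalPhenomena.PercolationContinuityZ3.Theorems.Quant

variable {d : ℕ}

/-- **Volume tail ⇒ (T1) with the same exponent**: if `P_{p_c}(|C(0)| ≥ k) ≤ A k^{−a}` for all `k ≥ 1` (`a ≥ 0`), then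
`OneArmPolyDecayAtCritical d a A` (`d ≥ 1`), since `{0 ↔ ∂Λ_n} ⊆ {|C(0)| ≥ n + 1}` and `(n+1)^{−a} ≤ n^{−a}`.
[cite: KozmaNachmias2011, proof of Lemma 2.3 (an arm to distance n has n+1 vertices)] -/
theorem oneArmPolyDecayAtCritical_of_volumeTail (hd : 1 ≤ d) {a A : ℝ} (ha : 0 ≤ a)
    (h : ∀ k : ℕ, 1 ≤ k → (bondPercolation (zdGraph d) (criticalProbI d)).real (clusterSizeGe (0 : Site d) k)
      ≤ A * (k : ℝ) ^ (-a)) :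
    OneArmPolyDecayAtCritical d a A := by
  intro n hn
  have hA : 0 ≤ A := by
    have := h 1 le_rfl
    have h1 : (bondPercolation (zdGraph d) (criticalProbI d)).real (clusterSizeGe (0 : Site d) 1) = 1 := by
      have : clusterSizeGe (0 : Site d) 1 = (Set.univ : Set (BondConfig (Site d))) := by
        ext ω
        simp only [mem_clusterSizeGe, Nat.cast_one, Set.mem_univ, iff_true, Set.one_le_encard_iff_nonempty]
        exact ⟨0, mem_openCluster_self _ _⟩
      rw [this, probReal_univ]
    rw [h1] at this
    have h2 : (1 : ℝ) ≤ A := by simpa using this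
    linarith
  have hn0 : (0 : ℝ) < n := by exact_mod_cast hn
  calc (bondPercolation (zdGraph d) (criticalProbI d)).real (siteToBoundary d n)
      = oneArmProb d (criticalProbI d) n := rfl
    _ ≤ (bondPercolation (zdGraph d) (criticalProbI d)).real (clusterSizeGe (0 : Site d) (n + 1)) :=
        Literature.Barriers.CriticalPhenomena.oneArmProb_le_real_clusterSizeGe hd _ n
    _ ≤ A * ((n + 1 : ℕ) : ℝ) ^ (-a) := h (n + 1) (by omega)
    _ ≤ A * (n : ℝ) ^ (-a) := by
        refine mul_le_mul_of_nonneg_left ?_ hA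
        rw [Real.rpow_neg (by positivity), Real.rpow_neg hn0.le]
        refine inv_anti₀ (Real.rpow_pos_of_pos hn0 a) (Real.rpow_le_rpow hn0.le ?_ ha)
        push_cast; linarith

/-- **(T1) ⟺ power-law critical volume tail (existential forms), `d ≥ 2`**: `OneArmPolyDecay d` iff
`∃ a > 0, ∃ A, ∀ k ≥ 1, P_{p_c}(|C(0)| ≥ k) ≤ A k^{−a}`.  Exponent bookkeeping: `c ↦ c/(d−c)` forward (two-box volume lemma),
`a ↦ a` backward.  [cite: BorgsChayesKestenSpencer1999, §1 (dρ ≥ δ+1)] [cite: KozmaNachmias2011, proof of Lemma 2.3] -/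
theorem oneArmPolyDecay_iff_volumeTail (hd : 2 ≤ d) :
    OneArmPolyDecay d ↔ ∃ a : ℝ, 0 < a ∧ ∃ A : ℝ, ∀ k : ℕ, 1 ≤ k →
      (bondPercolation (zdGraph d) (criticalProbI d)).real (clusterSizeGe (0 : Site d) k) ≤ A * (k : ℝ) ^ (-a) := by
  constructor
  · rintro ⟨c, hc, C, h⟩
    have hce := oneArmPolyDecayAtCritical_exponent_le hd h
    have hdc : 0 < (d : ℝ) - c := by
      have : (2 : ℝ) ≤ d := by exact_mod_cast hd
      linarith
    exact ⟨c / ((d : ℝ) - c), div_pos hc hdc, _,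
      fun k hk => volumeTail_criticalProbI_of_oneArmPolyDecay hd hc h k hk⟩
  · rintro ⟨a, ha, A, h⟩
    exact ⟨a, ha, A, oneArmPolyDecayAtCritical_of_volumeTail (by omega) ha.le h⟩

end Summit.CriticalPhenomena.PercolationContinuityZ3.Theorems.Quant

end
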